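import Summits.BirchSwinnertonDyer.BirchSwinnertonDyer.Theorems.ManinLocalTwoThreeKummerTriplingKubert
import Literature.NumberTheory.EllipticCurves.FormalGroupLaurentPoints
import Literature.NumberTheory.EllipticCurves.VariableChangePointsMap
import Literature.NumberTheory.EllipticCurves.FormalGroupDictionaryProofs
import HarnessLib

/-!
# The Kummer tripling identity read on the formal group: `Θ([3]s) · B³ = A³` with `A, B ∈ ℤ_p⟦q⟧`

Summit `BirchSwinnertonDyer`, route `ManinLocalTwoThree` (cell bsd-f2-manin), crux C3 `ManinPrimeToThreeAtNine`
(stmt-BirchSwinnertonDyer-22968); second brick of the proof of E-an-55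
`…ManinAdditive.CuspidalKummerThree.ManinThreeKummerCube` (MEMO-an §56.7), after
`ManinLocalTwoThreeKummerTriplingKubert` (`ω₃ = G³` on the Kubert normal form).
For a `p`-integral Weierstrass equation `V` with elliptic generic fibre `E = V ⊗ ℚ_p`, a `ℚ_p`-rational
point `T = (X₁, Y₁)` of order `3` with tangent slope `λ`, and a `p`-INTEGRAL parameter `s ∈ Xℤ_p⟦X⟧`,
`s ≠ 0`, put `D = [3](s)` and `Θ = −X(D) − Y₁D³ − λ·(X(D)·D − X₁D³)` (`X = formalXMulSq = z²x(z)`), i.e.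
`Θ = D³ · f_T(P)` for the tangent-line function `f_T = y − Y₁ − λ(x − X₁)` at the formal point
`P = P(D) = 3 • P(s)` (the tree's dictionary `laurentPt_formalMul`).  Moving `T` to `(0,0)` by the SCALED Kubert
change `(p^{-m}, X₁, λ, Y₁)` (Knapp V.5; `p^mX₁, p^mY₁, p^mλ` integral) turns `f_T` into the coordinate `y`, and
`kubert_y_three_smul` (`y(3Q)·ψ₃(Q)³ = G(Q)³`) gives, poles cleared, `kummerTripling_padic`:
**`∃ A B ∈ ℤ_p⟦X⟧, B ≠ 0, Θ · B³ = A³`** (`B = p^m·s·s⁸ψ₃(Q″)`, `A = D·s⁹G(Q″)`) — the `n = 3` analogue of the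
`2`-descent square `ManinLocalTwoThreeFormalKummerDoubling.formalXMulSq_formalMul_two_sub_root_mul_sq`.
No definitions; nothing about BSD, Manin's conjecture or any Manin constant is asserted.
-/

set_option autoImplicit false
set_option linter.dupNamespace false

noncomputable section

open scoped Classical LaurentSeries
open PowerSeries WeierstrassCurve Literature.NumberTheory.EllipticCurves

namespace Summit.BirchSwinnertonDyer.BirchSwinnertonDyer.Theorems.ManinLocalTwoThree

/-! ### §1 The scaled Kubert change of variables at a point of order `3` -/

section Kubert

variable {F : Type*} [Field F] (W : WeierstrassCurve F)

/-- **The scaled Kubert change.** For a nonsingular affine point `T = (x, y)` with `3 • T = O` (hence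
`2 • T ≠ O`), tangent slope `L`, and ANY unit `u`, the change of variables `(u, x, L, y)` carries `W` to the
normal form `E₃(u⁻¹(a₁ + 2L), u⁻³(2y + a₁x + a₃))` (Knapp V.5 (5.28)–(5.29); the tree's
`exists_variableChange_eq_kubertThree` is the case `u = 1`, whose computation is repeated here with the
weights `u⁻ⁱ`). [cite: Knapp1993, §V.5 (5.27)–(5.29) (PDF p. 110)] -/
theorem smul_eq_kubertThree_of_three_nsmul (u : Fˣ) {x y : F} (h : W.toAffine.Nonsingular x y)
    (h₃ : 3 • Affine.Point.some x y h = 0) :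
    (⟨u, x, W.toAffine.slope x x y y, y⟩ : VariableChange F) • W =
      kubertThree ((u⁻¹ : Fˣ) * (W.a₁ + 2 * W.toAffine.slope x x y y))
        (((u⁻¹ : Fˣ) : F) ^ 3 * (2 * y + W.a₁ * x + W.a₃)) := by
  -- `2 • T ≠ O` (else `T = 3T − 2T = O`)
  have h₂ : 2 • Affine.Point.some x y h ≠ 0 := fun h2 => by
    have e : 3 • Affine.Point.some x y h = 2 • Affine.Point.some x y h + Affine.Point.some x y h :=
      succ_nsmul _ 2
    rw [h₃, h2, zero_add] at e
    exact Affine.Point.some_ne_zero _ e.symm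
  have hq : y ≠ W.toAffine.negY x y := fun hy =>
    h₂ (by rw [two_nsmul, Affine.Point.add_self_of_Y_eq hy])
  set L := W.toAffine.slope x x y y with hL
  have h2P : 2 • Affine.Point.some x y h =
      Affine.Point.some (W.toAffine.addX x x L) (W.toAffine.addY x x y L)
        (Affine.nonsingular_add h h fun hxy => hq hxy.2) := by
    rw [two_nsmul, Affine.Point.add_self_of_Y_ne hq]
  have h2P' : 2 • Affine.Point.some x y h = -Affine.Point.some x y h := by
    rw [← add_eq_zero_iff_eq_neg, ← succ_nsmul]
    exact h₃
  have hd : W.toAffine.addX x x L = x := by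
    rw [h2P, Affine.Point.neg_some] at h2P'
    exact ((Affine.Point.some.injEq _ _ _ _ _ _).mp h2P').1
  set qq := y - W.toAffine.negY x y with hq_def
  have hq0 : qq ≠ 0 := sub_ne_zero.mpr hq
  have hLq : L * qq = 3 * x ^ 2 + 2 * W.a₂ * x + W.a₄ - W.a₁ * y := by
    rw [hL, Affine.slope_of_Y_ne rfl hq, ← hq_def, div_mul_cancel₀ _ hq0]
  have hqe : qq = 2 * y + W.a₁ * x + W.a₃ := by
    rw [hq_def, Affine.negY]
    ring
  have hde : 3 * x - L ^ 2 - W.a₁ * L + W.a₂ = 0 := by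
    have e : x - W.toAffine.addX x x L = 0 := by rw [hd, sub_self]
    rw [Affine.addX] at e
    linear_combination e
  have heq : y ^ 2 + W.a₁ * x * y + W.a₃ * y - (x ^ 3 + W.a₂ * x ^ 2 + W.a₄ * x + W.a₆) = 0 :=
    (Affine.equation_iff' x y).mp h.1
  rw [hqe] at hLq
  ext
  · simp only [variableChange_a₁, kubertThree_a₁]
  · simp only [variableChange_a₂, kubertThree_a₂]
    linear_combination ((u⁻¹ : Fˣ) : F) ^ 2 * hde
  · simp only [variableChange_a₃, kubertThree_a₃]
    ring
  · simp only [variableChange_a₄, kubertThree_a₄]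
    linear_combination -((u⁻¹ : Fˣ) : F) ^ 4 * hLq
  · simp only [variableChange_a₆, kubertThree_a₆]
    linear_combination -((u⁻¹ : Fˣ) : F) ^ 6 * heq

end Kubert

/-! ### §2 Small `p`-adic tools -/

section Padic

variable {p : ℕ} [Fact p.Prime]

/-- Monotonicity: if `p^m c` is integral then so is `p^(m + k) c` (`‖p^k‖ ≤ 1`). [folklore] -/
theorem norm_pow_add_mul_le_one {c : ℚ_[p]} {m : ℕ} (h : ‖(p : ℚ_[p]) ^ m * c‖ ≤ 1) (k : ℕ) :
    ‖(p : ℚ_[p]) ^ (m + k) * c‖ ≤ 1 := by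
  rw [pow_add, mul_comm ((p : ℚ_[p]) ^ m), mul_assoc, norm_mul]
  calc ‖(p : ℚ_[p]) ^ k‖ * ‖(p : ℚ_[p]) ^ m * c‖ ≤ 1 * 1 := by
        gcongr; rw [norm_pow]; exact pow_le_one₀ (norm_nonneg _) Padic.norm_p_lt_one.le
    _ = 1 := one_mul 1

/-- Three `p`-adic numbers become integral after multiplication by a common power of `p` (each one does:
`‖p^m c‖ = p^{-m}‖c‖ → 0`; the tree's `PadicQuadratic.exists_norm_pow_mul_le_one` is the case of one). [folklore] -/
theorem exists_norm_pow_mul_le_one₃ (c₁ c₂ c₃ : ℚ_[p]) :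
    ∃ m : ℕ, ‖(p : ℚ_[p]) ^ m * c₁‖ ≤ 1 ∧ ‖(p : ℚ_[p]) ^ m * c₂‖ ≤ 1 ∧ ‖(p : ℚ_[p]) ^ m * c₃‖ ≤ 1 := by
  have hp : (1 : ℝ) < p := by exact_mod_cast (Fact.out : p.Prime).one_lt
  have one : ∀ c : ℚ_[p], ∃ m : ℕ, ‖(p : ℚ_[p]) ^ m * c‖ ≤ 1 := fun c => by
    obtain ⟨m, hm⟩ := pow_unbounded_of_one_lt ‖c‖ hp
    refine ⟨m, ?_⟩
    rw [norm_mul, norm_pow, Padic.norm_p, inv_pow, ← div_eq_inv_mul]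
    exact (div_le_one (by positivity)).mpr hm.le
  obtain ⟨m₁, h₁⟩ := one c₁
  obtain ⟨m₂, h₂⟩ := one c₂
  obtain ⟨m₃, h₃⟩ := one c₃
  refine ⟨m₁ + m₂ + m₃, ?_, ?_, ?_⟩
  · rw [add_assoc]; exact norm_pow_add_mul_le_one h₁ _
  · rw [show m₁ + m₂ + m₃ = m₂ + (m₁ + m₃) by ring]; exact norm_pow_add_mul_le_one h₂ _
  · rw [show m₁ + m₂ + m₃ = m₃ + (m₁ + m₂) by ring]; exact norm_pow_add_mul_le_one h₃ _

end Padic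

/-! ### §3 The tripling identity on the formal group -/

section Main

variable {p : ℕ} [Fact p.Prime] (V : WeierstrassCurve ℤ_[p])
  [hE : (V.map PadicInt.Coe.ringHom).IsElliptic]

/-- **The Kummer tripling identity on the formal group, poles cleared, with `p`-integral witnesses.**
`V/ℤ_p` a Weierstrass equation with elliptic generic fibre `E`, `T = (X₁, Y₁) ∈ E(ℚ_p)` nonsingular with
`3 • T = O`, `λ` its tangent slope, `s ∈ Xℤ_p⟦X⟧` nonzero and `p`-integral with `D = [3](s) ≠ 0`.  Then the
series `Θ = −X(D) − Y₁D³ − λ(X(D)D − X₁D³)` (`= D³·f_T(3 • P(s))`, `f_T` the tangent line at `T`) satisfies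
`Θ·B³ = A³` for some `A, B ∈ ℤ_p⟦X⟧`, `B ≠ 0`.  Proof: `laurentPt_formalMul` (`P(D) = 3 • P(s)` in
`E(ℚ_p⸨X⸩)`), the scaled Kubert change `(p^{-m}, X₁, λ, Y₁)` (`smul_eq_kubertThree_of_three_nsmul`,
transported by `VariableChange.pointEquiv`), and `kubert_y_three_smul` (`y(3Q)ψ₃(Q)³ = G(Q)³`).
[cite: SilvermanAEC2009, Prop. VII.2.2 and Exercise 3.7(d) (shape: formal group = kernel of reduction; division values); Knapp1993, §V.5 (5.28)] -/
theorem kummerTripling_padic {X₁ Y₁ : ℚ_[p]}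
    (hT : (V.map PadicInt.Coe.ringHom).toAffine.Nonsingular X₁ Y₁)
    (h3T : 3 • Affine.Point.some X₁ Y₁ hT = 0)
    {s : ℚ_[p]⟦X⟧} (hs0 : constantCoeff s = 0) (hs : s ≠ 0) (hsint : IsPadicInt s)
    (hD : ((V.map PadicInt.Coe.ringHom).formalMul 3).subst s ≠ 0) :
    ∃ A B : (ℤ_[p])⟦X⟧, B ≠ 0 ∧
      (-(V.map PadicInt.Coe.ringHom).formalXMulSq.subst (((V.map PadicInt.Coe.ringHom).formalMul 3).subst s)
          - C Y₁ * ((V.map PadicInt.Coe.ringHom).formalMul 3).subst s ^ 3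
          - C ((V.map PadicInt.Coe.ringHom).toAffine.slope X₁ X₁ Y₁ Y₁) *
            ((V.map PadicInt.Coe.ringHom).formalXMulSq.subst (((V.map PadicInt.Coe.ringHom).formalMul 3).subst s)
                * ((V.map PadicInt.Coe.ringHom).formalMul 3).subst s
              - C X₁ * ((V.map PadicInt.Coe.ringHom).formalMul 3).subst s ^ 3)) *
        (B.map (PadicInt.Coe.ringHom (p := p))) ^ 3 = (A.map (PadicInt.Coe.ringHom (p := p))) ^ 3 := by
  haveI hInt : (V.map PadicInt.Coe.ringHom).IsIntegral ℤ_[p] := V.isIntegral_map_coe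
  set lam := (V.map PadicInt.Coe.ringHom).toAffine.slope X₁ X₁ Y₁ Y₁ with hlam
  set D := ((V.map PadicInt.Coe.ringHom).formalMul 3).subst s with hDdef
  have hD0 : constantCoeff D = 0 := by
    rw [hDdef, Literature.RingTheory.FormalGroups.constantCoeff_subst_of_constantCoeff_eq_zero hs0,
      (V.map PadicInt.Coe.ringHom).constantCoeff_formalMul]
  -- §a the scaling exponent
  obtain ⟨m, hmX, hmY, hmL⟩ := exists_norm_pow_mul_le_one₃ X₁ Y₁ lam
  set μ : ℚ_[p] := (p : ℚ_[p]) ^ m with hμ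
  have hμ0 : μ ≠ 0 := pow_ne_zero m (Nat.cast_ne_zero.mpr (Fact.out : p.Prime).ne_zero)
  have hμn : ‖μ‖ ≤ 1 := by rw [hμ, norm_pow]; exact pow_le_one₀ (norm_nonneg _) Padic.norm_p_lt_one.le
  set uμ : ℚ_[p]ˣ := (Units.mk0 μ hμ0)⁻¹ with huμ
  have huinv : ((uμ⁻¹ : ℚ_[p]ˣ) : ℚ_[p]) = μ := by rw [huμ, inv_inv, Units.val_mk0]
  -- §b the scaled Kubert change over `ℚ_p` and over `K = ℚ_p⸨X⸩`
  set a₁' : ℚ_[p] := μ * ((V.map PadicInt.Coe.ringHom).a₁ + 2 * lam) with ha₁'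
  set a₃' : ℚ_[p] := μ ^ 3 * (2 * Y₁ + (V.map PadicInt.Coe.ringHom).a₁ * X₁ + (V.map PadicInt.Coe.ringHom).a₃)
    with ha₃'
  have hC₀E : (⟨uμ, X₁, lam, Y₁⟩ : VariableChange ℚ_[p]) • (V.map PadicInt.Coe.ringHom) = kubertThree a₁' a₃' := by
    have h := smul_eq_kubertThree_of_three_nsmul (V.map PadicInt.Coe.ringHom) uμ hT h3T
    rwa [← hlam, huinv] at h
  set ι : ℚ_[p] →+* ℚ_[p]⸨X⸩ := algebraMap ℚ_[p] ℚ_[p]⸨X⸩ with hι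
  set CK : VariableChange ℚ_[p]⸨X⸩ := (⟨uμ, X₁, lam, Y₁⟩ : VariableChange ℚ_[p]).map ι with hCK
  have hCK_EK : CK • ((V.map PadicInt.Coe.ringHom).baseChange ℚ_[p]⸨X⸩) = kubertThree (ι a₁') (ι a₃') := by
    rw [hCK, WeierstrassCurve.baseChange, WeierstrassCurve.map_variableChange, hC₀E, map_kubertThree]
  -- §c the formal points `Q = P(s)` and `P = P(D) = 3 • Q`
  have hPQ : (V.map PadicInt.Coe.ringHom).laurentPt D hD0 = 3 • (V.map PadicInt.Coe.ringHom).laurentPt s hs0 :=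
    WeierstrassCurve.laurentPt_formalMul V PadicInt.Coe.ringHom two_ne_zero 3 hs0
  rw [laurentPt_of_ne_zero hs0 hs, laurentPt_of_ne_zero hD0 hD] at hPQ
  -- transport along the change of variables
  have hPQ' := congrArg (fun P => Affine.Point.congrEquiv hCK_EK (VariableChange.pointEquiv _ CK P)) hPQ
  simp only [map_nsmul, VariableChange.pointEquiv_some, Affine.Point.congrEquiv_some] at hPQ'
  -- §d coordinates of `Q″ = C_K(P(s))` and `P″ = C_K(P(D))`
  have hιC : ∀ a : ℚ_[p], ι a = ((C a : ℚ_[p]⟦X⟧) : ℚ_[p]⸨X⸩) := fun a => rfl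
  have hCKu : ((CK.u⁻¹ : ℚ_[p]⸨X⸩ˣ) : ℚ_[p]⸨X⸩) = ι μ := by
    change (((Units.map (ι : ℚ_[p] →* ℚ_[p]⸨X⸩) uμ)⁻¹ : ℚ_[p]⸨X⸩ˣ) : ℚ_[p]⸨X⸩) = ι μ
    rw [← map_inv, Units.coe_map, huinv]; rfl
  have htoX : ∀ x : ℚ_[p]⸨X⸩, CK.toX x = ι μ ^ 2 * (x - ι X₁) := fun x => by
    rw [VariableChange.toX_def, hCKu]; rfl
  have htoY : ∀ x y : ℚ_[p]⸨X⸩, CK.toY x y = ι μ ^ 3 * (y - ι lam * (x - ι X₁) - ι Y₁) := fun x y => by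
    rw [VariableChange.toY_def, hCKu]; rfl
  have hμK : ι μ ≠ 0 := (map_ne_zero ι).mpr hμ0
  -- name the transported points
  obtain ⟨hQ'', hP'', hPQ''⟩ : ∃ (hQ : (kubertThree (ι a₁') (ι a₃')).toAffine.Nonsingular
      (CK.toX ((V.map PadicInt.Coe.ringHom).laurentX s))
      (CK.toY ((V.map PadicInt.Coe.ringHom).laurentX s) ((V.map PadicInt.Coe.ringHom).laurentY s)))
      (hP : (kubertThree (ι a₁') (ι a₃')).toAffine.Nonsingular
      (CK.toX ((V.map PadicInt.Coe.ringHom).laurentX D))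
      (CK.toY ((V.map PadicInt.Coe.ringHom).laurentX D) ((V.map PadicInt.Coe.ringHom).laurentY D))),
      3 • Affine.Point.some _ _ hQ = Affine.Point.some _ _ hP := ⟨_, _, hPQ'.symm⟩
  clear hPQ'
  have hsc := coe_laurent_ne_zero hs
  have hDc := coe_laurent_ne_zero hD
  -- `ψ₂(Q) ≠ 0`: its numerator `−2X(s) + a₁sX(s) + a₃s³` has constant term `−2`
  have hψ₂Q : 2 * (V.map PadicInt.Coe.ringHom).laurentY s +
      ι (V.map PadicInt.Coe.ringHom).a₁ * (V.map PadicInt.Coe.ringHom).laurentX s +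
        ι (V.map PadicInt.Coe.ringHom).a₃ ≠ 0 := by
    set Nser : ℚ_[p]⟦X⟧ := -2 * (V.map PadicInt.Coe.ringHom).formalXMulSq.subst s +
      C (V.map PadicInt.Coe.ringHom).a₁ * s * (V.map PadicInt.Coe.ringHom).formalXMulSq.subst s +
        C (V.map PadicInt.Coe.ringHom).a₃ * s ^ 3 with hNser
    have hN0 : Nser ≠ 0 := by
      intro h0
      have h1 := congrArg constantCoeff h0
      simp only [hNser, map_add, map_mul, map_neg, map_pow, map_ofNat, constantCoeff_C, hs0,
        constantCoeff_formalXMulSq_subst (E := V.map PadicInt.Coe.ringHom) hs0, map_zero] at h1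
      norm_num at h1
    have hNc := coe_laurent_ne_zero hN0
    have key : 2 * (V.map PadicInt.Coe.ringHom).laurentY s +
        ι (V.map PadicInt.Coe.ringHom).a₁ * (V.map PadicInt.Coe.ringHom).laurentX s +
          ι (V.map PadicInt.Coe.ringHom).a₃ =
        ((Nser : ℚ_[p]⟦X⟧) : ℚ_[p]⸨X⸩) / ((s : ℚ_[p]⟦X⟧) : ℚ_[p]⸨X⸩) ^ 3 := by
      rw [laurentX, laurentY, hNser, hιC, hιC]
      simp only [PowerSeries.coe_add, PowerSeries.coe_pow, map_ofNat, map_neg, map_mul]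
      field_simp
    rw [key]
    exact div_ne_zero hNc (pow_ne_zero 3 hsc)
  have hu : 2 * CK.toY ((V.map PadicInt.Coe.ringHom).laurentX s) ((V.map PadicInt.Coe.ringHom).laurentY s) +
      ι a₁' * CK.toX ((V.map PadicInt.Coe.ringHom).laurentX s) + ι a₃' ≠ 0 := by
    have e : 2 * CK.toY ((V.map PadicInt.Coe.ringHom).laurentX s) ((V.map PadicInt.Coe.ringHom).laurentY s) +
        ι a₁' * CK.toX ((V.map PadicInt.Coe.ringHom).laurentX s) + ι a₃' =
        ι μ ^ 3 * (2 * (V.map PadicInt.Coe.ringHom).laurentY s +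
          ι (V.map PadicInt.Coe.ringHom).a₁ * (V.map PadicInt.Coe.ringHom).laurentX s +
            ι (V.map PadicInt.Coe.ringHom).a₃) := by
      rw [htoX, htoY, ha₁', ha₃']
      simp only [map_mul, map_add, map_pow, map_ofNat]
      ring
    rw [e]
    exact mul_ne_zero (pow_ne_zero 3 hμK) hψ₂Q
  -- §e the Kubert identity `y(3Q″)·Ψ₃(Q″)³ = G(Q″)³`
  have h2KK : (2 : ℚ_[p]⸨X⸩) ≠ 0 := by
    rw [show (2 : ℚ_[p]⸨X⸩) = ι 2 from (map_ofNat ι 2).symm]; exact (map_ne_zero ι).mpr two_ne_zero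
  obtain ⟨hy3, -⟩ := kubert_y_three_smul hQ'' h2KK hu hPQ''
  -- `Ψ₃(Q″) ≠ 0` since `3 • Q″ = P″ ≠ O`
  have hΨ3 : (kubertThree (ι a₁') (ι a₃')).Ψ₃.eval (CK.toX ((V.map PadicInt.Coe.ringHom).laurentX s)) ≠ 0 := by
    intro h0
    have e3 := (kubert_evalEval_ψ_two_three_four (a₁ := ι a₁') (a₃ := ι a₃')
      (CK.toX ((V.map PadicInt.Coe.ringHom).laurentX s))
      (CK.toY ((V.map PadicInt.Coe.ringHom).laurentX s) ((V.map PadicInt.Coe.ringHom).laurentY s))).2.1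
    have h30 : (3 : ℤ) • Affine.Point.some _ _ hQ'' = 0 :=
      (Affine.Point.zsmul_some_eq_zero_iff hQ'' 3).mpr (by rw [e3, h0])
    rw [show (3 : ℤ) • Affine.Point.some _ _ hQ'' = 3 • Affine.Point.some _ _ hQ'' from natCast_zsmul _ 3,
      hPQ''] at h30
    exact Affine.Point.some_ne_zero _ h30
  -- §f the series and the bridging identities in `K`
  set Xs_ := (V.map PadicInt.Coe.ringHom).formalXMulSq.subst s with hXs_
  set XD_ := (V.map PadicInt.Coe.ringHom).formalXMulSq.subst D with hXD_
  set Tser : ℚ_[p]⟦X⟧ := -XD_ - C Y₁ * D ^ 3 - C lam * (XD_ * D - C X₁ * D ^ 3) with hTser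
  set Xpp : ℚ_[p]⟦X⟧ := C μ ^ 2 * Xs_ - C μ * C (μ * X₁) * s ^ 2 with hXpp
  set Ypp : ℚ_[p]⟦X⟧ := -(C μ ^ 3 * Xs_) - C (μ * lam) * s * Xpp - C μ ^ 2 * C (μ * Y₁) * s ^ 3 with hYpp
  set Dser : ℚ_[p]⟦X⟧ := 3 * Xpp ^ 4 + C a₁' ^ 2 * Xpp ^ 3 * s ^ 2 + 3 * (C a₁' * C a₃') * Xpp ^ 2 * s ^ 4
    + 3 * C a₃' ^ 2 * Xpp * s ^ 6 with hDser
  set Gser : ℚ_[p]⟦X⟧ := Xpp ^ 3 * Ypp - 4 * C a₃' * Xpp ^ 3 * s ^ 3 - C a₁' * C a₃' * Xpp * Ypp * s ^ 4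
    - C a₁' ^ 2 * C a₃' * Xpp ^ 2 * s ^ 5 - 2 * C a₃' ^ 2 * Ypp * s ^ 6 - 2 * C a₁' * C a₃' ^ 2 * Xpp * s ^ 7
    - C a₃' ^ 3 * s ^ 9 with hGser
  have ex : ((s : ℚ_[p]⟦X⟧) : ℚ_[p]⸨X⸩) ^ 2 * CK.toX ((V.map PadicInt.Coe.ringHom).laurentX s) =
      ((Xpp : ℚ_[p]⟦X⟧) : ℚ_[p]⸨X⸩) := by
    rw [htoX, laurentX, hXpp, hιC, hιC]
    simp only [map_sub, map_mul, map_pow]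
    field_simp
    ring
  have ey : ((s : ℚ_[p]⟦X⟧) : ℚ_[p]⸨X⸩) ^ 3 *
      CK.toY ((V.map PadicInt.Coe.ringHom).laurentX s) ((V.map PadicInt.Coe.ringHom).laurentY s) =
      ((Ypp : ℚ_[p]⟦X⟧) : ℚ_[p]⸨X⸩) := by
    rw [htoY, laurentX, laurentY, hYpp, hXpp, hιC, hιC, hιC, hιC]
    simp only [map_sub, map_neg, map_mul, map_pow]
    field_simp
    ring
  have eT : ((D : ℚ_[p]⟦X⟧) : ℚ_[p]⸨X⸩) ^ 3 *
      CK.toY ((V.map PadicInt.Coe.ringHom).laurentX D) ((V.map PadicInt.Coe.ringHom).laurentY D) =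
      ι μ ^ 3 * ((Tser : ℚ_[p]⟦X⟧) : ℚ_[p]⸨X⸩) := by
    rw [htoY, laurentX, laurentY, hTser, hιC, hιC, hιC, hιC]
    simp only [map_sub, map_neg, map_mul, map_pow]
    field_simp
    ring
  have ex' : CK.toX ((V.map PadicInt.Coe.ringHom).laurentX s) =
      ((Xpp : ℚ_[p]⟦X⟧) : ℚ_[p]⸨X⸩) / ((s : ℚ_[p]⟦X⟧) : ℚ_[p]⸨X⸩) ^ 2 := by rw [eq_div_iff (pow_ne_zero 2 hsc), mul_comm]; exact ex
  have ey' : CK.toY ((V.map PadicInt.Coe.ringHom).laurentX s) ((V.map PadicInt.Coe.ringHom).laurentY s) =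
      ((Ypp : ℚ_[p]⟦X⟧) : ℚ_[p]⸨X⸩) / ((s : ℚ_[p]⟦X⟧) : ℚ_[p]⸨X⸩) ^ 3 := by rw [eq_div_iff (pow_ne_zero 3 hsc), mul_comm]; exact ey
  have eD : ((Dser : ℚ_[p]⟦X⟧) : ℚ_[p]⸨X⸩) = ((s : ℚ_[p]⟦X⟧) : ℚ_[p]⸨X⸩) ^ 8 *
      (kubertThree (ι a₁') (ι a₃')).Ψ₃.eval (CK.toX ((V.map PadicInt.Coe.ringHom).laurentX s)) := by
    rw [kubert_Ψ₃_eval, ex', hDser, hιC, hιC]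
    simp only [map_add, map_mul, map_pow, map_ofNat]
    field_simp
  have eG : ((Gser : ℚ_[p]⟦X⟧) : ℚ_[p]⸨X⸩) = ((s : ℚ_[p]⟦X⟧) : ℚ_[p]⸨X⸩) ^ 9 *
      (CK.toX ((V.map PadicInt.Coe.ringHom).laurentX s) ^ 3 *
          CK.toY ((V.map PadicInt.Coe.ringHom).laurentX s) ((V.map PadicInt.Coe.ringHom).laurentY s)
        - 4 * ι a₃' * CK.toX ((V.map PadicInt.Coe.ringHom).laurentX s) ^ 3
        - ι a₁' * ι a₃' * CK.toX ((V.map PadicInt.Coe.ringHom).laurentX s) *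
          CK.toY ((V.map PadicInt.Coe.ringHom).laurentX s) ((V.map PadicInt.Coe.ringHom).laurentY s)
        - ι a₁' ^ 2 * ι a₃' * CK.toX ((V.map PadicInt.Coe.ringHom).laurentX s) ^ 2
        - 2 * ι a₃' ^ 2 * CK.toY ((V.map PadicInt.Coe.ringHom).laurentX s) ((V.map PadicInt.Coe.ringHom).laurentY s)
        - 2 * ι a₁' * ι a₃' ^ 2 * CK.toX ((V.map PadicInt.Coe.ringHom).laurentX s) - ι a₃' ^ 3) := by
    rw [ex', ey', hGser, hιC, hιC]
    simp only [map_sub, map_mul, map_pow, map_ofNat]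
    field_simp
  -- §g the identity `Θ · (μ s 𝒟)³ = (D 𝒢)³` in `ℚ_p⟦X⟧`
  have hmain : Tser * (C μ * s * Dser) ^ 3 = (D * Gser) ^ 3 := by
    apply HahnSeries.ofPowerSeries_injective (Γ := ℤ) (R := ℚ_[p])
    simp only [map_mul, map_pow]
    rw [eD, eG, ← hιC]
    linear_combination -(((s : ℚ_[p]⟦X⟧) : ℚ_[p]⸨X⸩) ^ 27 *
        ((kubertThree (ι a₁') (ι a₃')).Ψ₃.eval (CK.toX ((V.map PadicInt.Coe.ringHom).laurentX s))) ^ 3) * eT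
      + (((D : ℚ_[p]⟦X⟧) : ℚ_[p]⸨X⸩) ^ 3 * ((s : ℚ_[p]⟦X⟧) : ℚ_[p]⸨X⸩) ^ 27) * hy3
  -- §h integrality of the witnesses
  have hss : HasSubst s := HasSubst.of_constantCoeff_zero' hs0
  have hDs : HasSubst D := HasSubst.of_constantCoeff_zero' hD0
  have hXsint : IsPadicInt Xs_ := by
    rw [hXs_, ← map_formalXMulSq]; exact (isPadicInt_map _).powerSeries_subst hsint hss
  have hDint : IsPadicInt D := by
    rw [hDdef, ← map_formalMul]; exact (isPadicInt_map _).powerSeries_subst hsint hss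
  have hXDint : IsPadicInt XD_ := by
    rw [hXD_, ← map_formalXMulSq]; exact (isPadicInt_map _).powerSeries_subst hDint hDs
  have hcμ : IsPadicInt (C μ : ℚ_[p]⟦X⟧) := IsPadicInt.powerSeries_C hμn
  have hcX : IsPadicInt (C (μ * X₁) : ℚ_[p]⟦X⟧) := IsPadicInt.powerSeries_C hmX
  have hcY : IsPadicInt (C (μ * Y₁) : ℚ_[p]⟦X⟧) := IsPadicInt.powerSeries_C hmY
  have hcL : IsPadicInt (C (μ * lam) : ℚ_[p]⟦X⟧) := IsPadicInt.powerSeries_C hmL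
  have hca₁ : IsPadicInt (C (V.map PadicInt.Coe.ringHom).a₁ : ℚ_[p]⟦X⟧) :=
    IsPadicInt.powerSeries_C (by rw [map_a₁]; exact PadicInt.norm_le_one _)
  have hca₃ : IsPadicInt (C (V.map PadicInt.Coe.ringHom).a₃ : ℚ_[p]⟦X⟧) :=
    IsPadicInt.powerSeries_C (by rw [map_a₃]; exact PadicInt.norm_le_one _)
  have hnat : ∀ n : ℕ, IsPadicInt ((n : ℚ_[p]⟦X⟧)) := fun n => by
    rw [show ((n : ℚ_[p]⟦X⟧)) = C (n : ℚ_[p]) from (map_natCast C n).symm]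
    exact IsPadicInt.powerSeries_C (by simpa using Padic.norm_int_le_one (p := p) n)
  have h2i : IsPadicInt (2 : ℚ_[p]⟦X⟧) := by simpa using hnat 2
  have h3i : IsPadicInt (3 : ℚ_[p]⟦X⟧) := by simpa using hnat 3
  have h4i : IsPadicInt (4 : ℚ_[p]⟦X⟧) := by simpa using hnat 4
  have hA1 : (C a₁' : ℚ_[p]⟦X⟧) = C μ * C (V.map PadicInt.Coe.ringHom).a₁ + 2 * C (μ * lam) := by
    rw [ha₁']; simp only [map_mul, map_add, map_ofNat]; ring
  have hA1int : IsPadicInt (C a₁' : ℚ_[p]⟦X⟧) := by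
    rw [hA1]; exact (hcμ.mul hca₁).add (h2i.mul hcL)
  have hA3 : (C a₃' : ℚ_[p]⟦X⟧) = 2 * C μ ^ 2 * C (μ * Y₁) +
      C μ ^ 2 * C (V.map PadicInt.Coe.ringHom).a₁ * C (μ * X₁) + C μ ^ 3 * C (V.map PadicInt.Coe.ringHom).a₃ := by
    rw [ha₃']; simp only [map_mul, map_add, map_pow, map_ofNat]; ring
  have hA3int : IsPadicInt (C a₃' : ℚ_[p]⟦X⟧) := by
    rw [hA3]
    exact (((h2i.mul (hcμ.pow 2)).mul hcY).add (((hcμ.pow 2).mul hca₁).mul hcX)).add ((hcμ.pow 3).mul hca₃)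
  have hXppint : IsPadicInt Xpp := ((hcμ.pow 2).mul hXsint).sub ((hcμ.mul hcX).mul (hsint.pow 2))
  have hYppint : IsPadicInt Ypp :=
    ((((hcμ.pow 3).mul hXsint).neg).sub ((hcL.mul hsint).mul hXppint)).sub (((hcμ.pow 2).mul hcY).mul (hsint.pow 3))
  have hDserint : IsPadicInt Dser :=
    (((h3i.mul (hXppint.pow 4)).add (((hA1int.pow 2).mul (hXppint.pow 3)).mul (hsint.pow 2))).add
      (((h3i.mul (hA1int.mul hA3int)).mul (hXppint.pow 2)).mul (hsint.pow 4))).add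
      (((h3i.mul (hA3int.pow 2)).mul hXppint).mul (hsint.pow 6))
  have hGserint : IsPadicInt Gser :=
    (((((((hXppint.pow 3).mul hYppint).sub (((h4i.mul hA3int).mul (hXppint.pow 3)).mul (hsint.pow 3))).sub
      ((((hA1int.mul hA3int).mul hXppint).mul hYppint).mul (hsint.pow 4))).sub
      ((((hA1int.pow 2).mul hA3int).mul (hXppint.pow 2)).mul (hsint.pow 5))).sub
      (((h2i.mul (hA3int.pow 2)).mul hYppint).mul (hsint.pow 6))).sub
      ((((h2i.mul hA1int).mul (hA3int.pow 2)).mul hXppint).mul (hsint.pow 7))).sub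
      ((hA3int.pow 3).mul (hsint.pow 9))
  have hBint : IsPadicInt (C μ * s * Dser) := (hcμ.mul hsint).mul hDserint
  have hAint : IsPadicInt (D * Gser) := hDint.mul hGserint
  obtain ⟨A₁, hA₁⟩ := isPadicInt_iff_exists_powerSeries_map.mp hAint
  obtain ⟨B₁, hB₁⟩ := isPadicInt_iff_exists_powerSeries_map.mp hBint
  -- §i `B ≠ 0`
  have hDser0 : Dser ≠ 0 := by
    intro h0
    have h1 : ((Dser : ℚ_[p]⟦X⟧) : ℚ_[p]⸨X⸩) = 0 := by rw [h0, map_zero]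
    rw [eD] at h1
    exact (mul_ne_zero (pow_ne_zero 8 hsc) hΨ3) h1
  have hCμ0 : (C μ : ℚ_[p]⟦X⟧) ≠ 0 := fun h0 => by
    have h1 := congrArg constantCoeff h0
    exact hμ0 (by rwa [constantCoeff_C, map_zero] at h1)
  have hBne : B₁ ≠ 0 := fun h0 => by
    rw [h0, map_zero] at hB₁
    exact (mul_ne_zero (mul_ne_zero hCμ0 hs) hDser0) hB₁.symm
  refine ⟨A₁, B₁, hBne, ?_⟩
  rw [hA₁, hB₁]
  exact hmain

end Main

end Summit.BirchSwinnertonDyer.BirchSwinnertonDyer.Theorems.ManinLocalTwoThree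

end
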